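import Mathlib
import HarnessLib
import Summits.NavierStokesRegularity.NavierStokesRegularity.Theorems.UnthreadedDoorAntidynamoWallBeltramiModConst

/-!
# Route `UnthreadedDoor` / `ThreadingFlux`, crux `PoloidalLiouville` (stmt-NavierStokesRegularity-1222), antidynamo v2 skeleton (sha16 `4ebf5683127b`),
# WALL `stub_scalarLiouville`: the CO-MOVING RIGID FRAME — a bounded Killing-caloric vorticity tangent to spheres vanishes

Support file (seat leafhand-ns-unthreadeddoor-2 g4, cell decomp-ns), `--supports stmt-NavierStokesRegularity-1222 --as helper`; theorems only.
Part 1 of 2 of the Killing-frame sector (part 2: `…WallBeltramiKilling`, the closers).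

The Galilean sector of the wall (Lamb vector curl-free in a translating frame: p816997, p821303, p821364, p822418) is the translation subgroup of the
Euclidean group.  For the full group take a KILLING drift `ξ(y) = b + Ω × y` (infinitesimal screw motion).  If the vorticity obeys the
«Killing-caloric» law `∂ₜω + (ξ·∇)ω − Ω × ω = Δω` on a far past `(−∞, t₁)` (it is Lie-transported by the rigid motion generated by `ξ`, up to
diffusion), then in the CO-MOVING RIGID FRAME `θ(t, y) = e^{−tJ} ω(t, e^{tJ} y + c(t))` (`J = Ω × ·`, `c(t) = t b∥ + (e^{tJ} − 1)p'` where
`b = b∥ + Ω × p'`, `Ω × b∥ = 0`) it solves the HEAT EQUATION (`e^{−tJ}` commutes with `J`; the Laplacian is invariant under rigid motions), it is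
bounded, so by the tree's heat Liouville theorem (`Literature.Analysis.PDE.heat_liouville`) every slice of `ω` is a constant field — and a constant
field tangent to the spheres about `x₀` vanishes.  No Navier–Stokes covariance under rotating frames is used (there is none): only the vorticity FIELD
is transported.

* §1 the one-parameter rotation group `e^{tJ}` (`NormedSpace.exp` in `ℝ³ →L ℝ³`): skewness of `J`, derivatives, group law, commutation with `J`,
  preservation of the inner product and of the norm; a Killing field has derivative `J` and is divergence free; the axis decomposition of `b`;
* §2 ★★ `curl_eq_zero_of_killingCaloric_unthreaded` — a bounded Killing-caloric vorticity tangent to the spheres about a point vanishes on the far past.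

HONEST LABEL: frame calculus + the tree's heat Liouville theorem; the generic core of the wall (= (ML-a)) is OPEN; nothing here proves
`stub_scalarLiouville`, `PoloidalLiouville` (1222), or bears on Navier–Stokes regularity; no summit statement is proved.
[folklore] [cite: MajdaBertozziCUP2002, §1.1 (vector identities); KochNadirashviliSereginSverak2009, Thm 5.2 (arXiv:0709.3599 pp. 9–10)]
-/

noncomputable section

-- the summit and its single sub-problem share the name (CONVENTIONS §1)
set_option linter.dupNamespace false

open scoped Topology InnerProductSpace RealInnerProductSpace ContDiff Laplacian
open Filter Set Function MeasureTheory
open Literature.Analysis Literature.Analysis.FluidPDE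

namespace Summit.NavierStokesRegularity.NavierStokesRegularity.Theorems.PoloidalLiouville.Antidynamo

open Summit.NavierStokesRegularity.NavierStokesRegularity.Theorems.PoloidalLiouville
  (toroidalPotential exists_norm_curl_le constantOfIrrotational vorticityOfClass)
open Summit.NavierStokesRegularity.NavierStokesRegularity.Theorems.PoloidalLiouville.NetFlux (E3)

namespace Killing

/-! ### §1 The rotation group generated by `J = Ω × ·` -/

/-- `J = Ω × ·` is skew: `⟪J a, c⟫ = −⟪a, J c⟫`. [folklore] -/
theorem inner_crossCLM_skew (Ω a c : E3) : ⟪crossCLM Ω a, c⟫ = -⟪a, crossCLM Ω c⟫ := by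
  simp [crossCLM_apply, cross, crossProduct, PiLp.inner_apply, Fin.sum_univ_three]
  ring

/-- `⟪J a, a⟫ = 0`. [folklore] -/
theorem inner_crossCLM_self (Ω a : E3) : ⟪crossCLM Ω a, a⟫ = 0 := by
  simp [crossCLM_apply, cross, crossProduct, PiLp.inner_apply, Fin.sum_univ_three]
  ring

/-- `d/du (e^{uJ} y) = J e^{uJ} y`. [folklore] -/
theorem hasDerivAt_exp_apply (J : E3 →L[ℝ] E3) (y : E3) (s : ℝ) :
    HasDerivAt (fun u : ℝ => NormedSpace.exp (u • J) y) (J (NormedSpace.exp (s • J) y)) s := by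
  have h := (hasDerivAt_exp_smul_const' (𝕂 := ℝ) J s).clm_apply (hasDerivAt_const s y)
  simpa using h

/-- `d/du (e^{−uJ} y) = −J e^{−uJ} y`. [folklore] -/
theorem hasDerivAt_exp_neg_apply (J : E3 →L[ℝ] E3) (y : E3) (s : ℝ) :
    HasDerivAt (fun u : ℝ => NormedSpace.exp ((-u) • J) y) (-(J (NormedSpace.exp ((-s) • J) y))) s := by
  have h := (hasDerivAt_exp_apply J y (-s)).scomp s (hasDerivAt_neg' s)
  have e : ((fun u : ℝ => NormedSpace.exp (u • J) y) ∘ Neg.neg) = fun u : ℝ => NormedSpace.exp ((-u) • J) y := rfl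
  rw [e, neg_one_smul] at h
  exact h

/-- `(f * g) x = f (g x)` for continuous linear maps (composition). [folklore] -/
theorem clm_mul_apply (f g : E3 →L[ℝ] E3) (x : E3) : (f * g) x = f (g x) := rfl

/-- `u ↦ e^{uJ}` is smooth. [folklore] -/
theorem contDiff_exp_smul (J : E3 →L[ℝ] E3) : ContDiff ℝ ∞ (fun u : ℝ => NormedSpace.exp (u • J)) := by
  have h1 : AnalyticOnNhd ℝ (fun x : E3 →L[ℝ] E3 => NormedSpace.exp x) univ := fun x _ => NormedSpace.exp_analytic x
  exact h1.contDiff.comp (contDiff_id.smul contDiff_const)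

/-- Group law: `e^{sJ} (e^{uJ} y) = e^{(s+u)J} y`. [folklore] -/
theorem exp_apply_exp_apply (J : E3 →L[ℝ] E3) (s u : ℝ) (y : E3) :
    NormedSpace.exp (s • J) (NormedSpace.exp (u • J) y) = NormedSpace.exp ((s + u) • J) y := by
  letI : NormedAlgebra ℚ (E3 →L[ℝ] E3) := NormedAlgebra.restrictScalars ℚ ℝ (E3 →L[ℝ] E3)
  have hc : Commute (s • J) (u • J) := by
    change (s • J) * (u • J) = (u • J) * (s • J)
    ext x
    simp [smul_smul, mul_comm s u]
  have h := NormedSpace.exp_add_of_commute hc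
  rw [show s • J + u • J = (s + u) • J from (add_smul s u J).symm] at h
  rw [h]
  rfl

/-- `e^{−sJ} (e^{sJ} y) = y`. [folklore] -/
theorem exp_neg_apply_exp_apply (J : E3 →L[ℝ] E3) (s : ℝ) (y : E3) :
    NormedSpace.exp ((-s) • J) (NormedSpace.exp (s • J) y) = y := by
  rw [exp_apply_exp_apply, neg_add_cancel, show (0 : ℝ) • J = 0 from zero_smul ℝ J, NormedSpace.exp_zero]
  rfl

/-- `e^{sJ} (e^{−sJ} y) = y`. [folklore] -/
theorem exp_apply_exp_neg_apply (J : E3 →L[ℝ] E3) (s : ℝ) (y : E3) :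
    NormedSpace.exp (s • J) (NormedSpace.exp ((-s) • J) y) = y := by
  rw [exp_apply_exp_apply, add_neg_cancel, show (0 : ℝ) • J = 0 from zero_smul ℝ J, NormedSpace.exp_zero]
  rfl

/-- `J` commutes with `e^{sJ}`. [folklore] -/
theorem crossCLM_exp_apply (J : E3 →L[ℝ] E3) (s : ℝ) (y : E3) :
    J (NormedSpace.exp (s • J) y) = NormedSpace.exp (s • J) (J y) := by
  have hc : Commute J (NormedSpace.exp (s • J)) := by
    refine Commute.exp_right ?_
    change J * (s • J) = (s • J) * J
    ext x
    simp
  rw [← clm_mul_apply, hc.eq, clm_mul_apply]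

/-- The rotations `e^{tJ}`, `J = Ω × ·`, preserve the inner product. [folklore] -/
theorem inner_exp_crossCLM (Ω y z : E3) (t : ℝ) :
    ⟪NormedSpace.exp (t • crossCLM Ω) y, NormedSpace.exp (t • crossCLM Ω) z⟫ = ⟪y, z⟫ := by
  have hd : ∀ s, HasDerivAt (fun u : ℝ => ⟪NormedSpace.exp (u • crossCLM Ω) y, NormedSpace.exp (u • crossCLM Ω) z⟫) 0 s := by
    intro s
    have h := HasDerivAt.inner ℝ (hasDerivAt_exp_apply (crossCLM Ω) y s) (hasDerivAt_exp_apply (crossCLM Ω) z s)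
    have e0 : ⟪NormedSpace.exp (s • crossCLM Ω) y, crossCLM Ω (NormedSpace.exp (s • crossCLM Ω) z)⟫ +
        ⟪crossCLM Ω (NormedSpace.exp (s • crossCLM Ω) y), NormedSpace.exp (s • crossCLM Ω) z⟫ = 0 := by
      rw [inner_crossCLM_skew Ω (NormedSpace.exp (s • crossCLM Ω) y)]
      ring
    exact h.congr_deriv e0
  have hdiff : Differentiable ℝ (fun u : ℝ => ⟪NormedSpace.exp (u • crossCLM Ω) y, NormedSpace.exp (u • crossCLM Ω) z⟫) :=
    fun s => (hd s).differentiableAt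
  have hconst := is_const_of_deriv_eq_zero hdiff (fun s => (hd s).deriv) t 0
  have e1 : NormedSpace.exp ((0 : ℝ) • crossCLM Ω) = (1 : E3 →L[ℝ] E3) := by
    rw [show (0 : ℝ) • crossCLM Ω = 0 from zero_smul ℝ (crossCLM Ω), NormedSpace.exp_zero]
  rw [e1] at hconst
  simpa using hconst

/-- … hence preserve norms. [folklore] -/
theorem norm_exp_crossCLM (Ω y : E3) (t : ℝ) : ‖NormedSpace.exp (t • crossCLM Ω) y‖ = ‖y‖ := by
  have h := inner_exp_crossCLM Ω y y t
  rw [real_inner_self_eq_norm_sq, real_inner_self_eq_norm_sq] at h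
  exact (sq_eq_sq₀ (norm_nonneg _) (norm_nonneg _)).1 h

/-- A Killing field `y ↦ b + Ω × y` has derivative `J`. [folklore] -/
theorem hasFDerivAt_killing (b Ω x : E3) : HasFDerivAt (fun y : E3 => b + crossCLM Ω y) (crossCLM Ω) x :=
  ((crossCLM Ω).hasFDerivAt).const_add b

/-- A Killing field is divergence free (`tr J = 0`). [folklore] -/
theorem divergence_killing (b Ω x : E3) : VectorCalculus.divergence (fun y : E3 => b + crossCLM Ω y) x = 0 := by
  rw [divergence_eq_sum_inner_fderiv (EuclideanSpace.basisFun (Fin 3) ℝ), (hasFDerivAt_killing b Ω x).fderiv]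
  refine Finset.sum_eq_zero fun i _ => ?_
  rw [real_inner_comm]
  exact inner_crossCLM_self Ω _

/-- Decomposition of the translation part along / across the rotation axis: `b = b∥ + Ω × p'` with `Ω × b∥ = 0`. [folklore] -/
theorem exists_killing_decomposition (b Ω : E3) :
    ∃ bpar p' : E3, crossCLM Ω bpar = 0 ∧ crossCLM Ω p' = b - bpar := by
  have hself : crossCLM Ω Ω = 0 := by
    ext i
    fin_cases i <;> simp [crossCLM_apply, cross, crossProduct] <;> ring
  by_cases hΩ : Ω = 0
  · exact ⟨b, 0, by simp [hΩ], by simp⟩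
  · have hn : ‖Ω‖ ^ 2 ≠ 0 := pow_ne_zero 2 (norm_ne_zero_iff.2 hΩ)
    have hn2 : ‖Ω‖ ^ 2 = Ω 0 ^ 2 + Ω 1 ^ 2 + Ω 2 ^ 2 := by
      simp [EuclideanSpace.real_norm_sq_eq, Fin.sum_univ_three]
    refine ⟨(⟪Ω, b⟫ / ‖Ω‖ ^ 2) • Ω, (1 / ‖Ω‖ ^ 2) • cross b Ω, ?_, ?_⟩
    · rw [map_smul, hself, smul_zero]
    · have key : cross Ω (cross b Ω) = (‖Ω‖ ^ 2) • b - ⟪Ω, b⟫ • Ω := by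
        rw [hn2]
        ext i
        fin_cases i <;> simp [cross, crossProduct, PiLp.inner_apply, Fin.sum_univ_three] <;> ring
      rw [map_smul, crossCLM_apply, key, smul_sub, smul_smul, smul_smul, one_div, inv_mul_cancel₀ hn, one_smul,
        div_eq_inv_mul]

/-! ### §2 A bounded Killing-caloric vorticity tangent to spheres vanishes -/

/-- ★★ **A BOUNDED VORTICITY SOLVING `∂ₜω = Δω + Jω − Dω[ξ]` FOR A KILLING FIELD `ξ = b + J·`, `J = Ω × ·`, TANGENT TO THE SPHERES ABOUT A POINT,
VANISHES ON THE FAR PAST.**  In the co-moving rigid frame `θ(t,y) = e^{−tJ} ω(t, c(t) + e^{tJ} y)` (`c(t) = t b∥ + (e^{tJ} − 1)p'`) the field solves the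
heat equation on `(−∞, t₁) × ℝ³` and is bounded; by `Literature.Analysis.PDE.heat_liouville` it is one constant, so every slice of `ω` is a constant
field, and a constant field tangent to the spheres about `x₀` is zero. [folklore] -/
theorem curl_eq_zero_of_killingCaloric_unthreaded
    {v : ℝ → EuclideanSpace ℝ (Fin 3) → EuclideanSpace ℝ (Fin 3)} (hV : IsVorticitySolutionOn (Iio 0) 1 v)
    {K : ℝ} (hK : ∀ t < 0, ∀ x, ‖curl (v t) x‖ ≤ K) (x₀ : EuclideanSpace ℝ (Fin 3))
    (hun : ∀ t < 0, ∀ x, ⟪x - x₀, curl (v t) x⟫ = 0)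
    (b Ω : EuclideanSpace ℝ (Fin 3)) {t₁ : ℝ} (ht₁ : t₁ ≤ 0)
    (hlaw : ∀ t < t₁, ∀ x, timeDerivWithin (Iio 0) (vorticity v) t x =
      (Δ (vorticity v t)) x + crossCLM Ω (vorticity v t x) - fderiv ℝ (vorticity v t) x (b + crossCLM Ω x)) :
    ∀ t < t₁, ∀ x, curl (v t) x = 0 := by
  have hsm : IsSmoothSpaceTimeOn (Iio 0) v := hV.smooth_velocity
  have hsmω : IsSmoothSpaceTimeOn (Iio 0) (vorticity v) := hsm.isSmoothSpaceTimeOn_vorticity isOpen_Iio.uniqueDiffOn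
  have hO : IsOpen (Iio (0 : ℝ) ×ˢ (univ : Set (EuclideanSpace ℝ (Fin 3)))) := isOpen_Iio.prod isOpen_univ
  have hO₁ : IsOpen (Iio t₁ ×ˢ (univ : Set (EuclideanSpace ℝ (Fin 3)))) := isOpen_Iio.prod isOpen_univ
  have hsub₁ : Iio t₁ ×ˢ (univ : Set (EuclideanSpace ℝ (Fin 3))) ⊆ Iio (0 : ℝ) ×ˢ univ :=
    prod_mono (Iio_subset_Iio ht₁) le_rfl
  have hωinf : ContDiffOn ℝ ∞ (uncurry (vorticity v)) (Iio (0 : ℝ) ×ˢ univ) := hsmω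
  -- the rotation group and the translation part of the co-moving frame
  set J : E3 →L[ℝ] E3 := crossCLM Ω with hJ
  set E : ℝ → (E3 →L[ℝ] E3) := fun u => NormedSpace.exp (u • J) with hE
  have hEinf : ContDiff ℝ ∞ E := contDiff_exp_smul J
  obtain ⟨bpar, p', hJbpar, hJp'⟩ := exists_killing_decomposition b Ω
  set c : ℝ → E3 := fun u => u • bpar + E u p' - p' with hc
  have hEd : ∀ u (y : E3), HasDerivAt (fun s => E s y) (J (E u y)) u := fun u y => hasDerivAt_exp_apply J y u
  have hcd : ∀ u, HasDerivAt c (bpar + J (E u p')) u := fun u => by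
    have h := (((hasDerivAt_id u).smul_const bpar).add (hEd u p')).sub_const p'
    simp only [id_eq, one_smul] at h
    exact h
  have hJbpar' : J bpar = 0 := hJbpar
  have hJp'' : J p' = b - bpar := hJp'
  -- `∂ᵤ (E u y + c u) = ξ (E u y + c u)`
  have hframe : ∀ u (y : E3), J (E u y) + (bpar + J (E u p')) = b + J (E u y + c u) := by
    intro u y
    simp only [hc, map_add, map_sub, map_smul, hJbpar', hJp'', smul_zero]
    abel
  have hcinf : ContDiff ℝ ∞ c := by
    refine ((contDiff_id.smul contDiff_const).add ?_).sub contDiff_const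
    exact hEinf.clm_apply contDiff_const
  set Φ : ℝ × E3 → ℝ × E3 := fun p => (p.1, E p.1 p.2 + c p.1) with hΦ
  have hΦs : ContDiff ℝ ∞ Φ := by
    refine contDiff_fst.prodMk (((hEinf.comp contDiff_fst).clm_apply contDiff_snd).add (hcinf.comp contDiff_fst))
  have hΦmaps : MapsTo Φ (Iio (0 : ℝ) ×ˢ univ) (Iio (0 : ℝ) ×ˢ univ) := fun p hp => ⟨hp.1, mem_univ _⟩
  set θ : ℝ → E3 → E3 := fun t y => E (-t) (curl (v t) (E t y + c t)) with hθ
  have hθeq : uncurry θ = fun p : ℝ × E3 => E (-p.1) ((uncurry (vorticity v) ∘ Φ) p) := by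
    funext p
    obtain ⟨t, y⟩ := p
    simp [hθ, hΦ, vorticity_apply]
  have hθinf : ContDiffOn ℝ ∞ (uncurry θ) (Iio (0 : ℝ) ×ˢ univ) := by
    rw [hθeq]
    exact ((hEinf.comp contDiff_neg).comp contDiff_fst).contDiffOn.clm_apply (hωinf.comp hΦs.contDiffOn hΦmaps)
  have hθ2 : ContDiffOn ℝ 2 (uncurry θ) (Iio (0 : ℝ) ×ˢ univ) := hθinf.of_le (by norm_cast)
  have hω2 : ContDiffOn ℝ 2 (uncurry (vorticity v)) (Iio (0 : ℝ) ×ˢ univ) := hωinf.of_le (by norm_cast)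
  -- the co-moving rotation as a linear isometry equivalence (for the invariance of the Laplacian)
  have hRot : ∀ t : ℝ, ∃ R : E3 ≃ₗᵢ[ℝ] E3, (∀ w, R w = E (-t) w) ∧ ∀ w, R.symm w = E t w := by
    intro t
    let L : E3 ≃ₗ[ℝ] E3 :=
      { toFun := fun w => E (-t) w
        invFun := fun w => E t w
        map_add' := fun w w' => map_add _ _ _
        map_smul' := fun r w => map_smul _ _ _
        left_inv := fun w => exp_apply_exp_neg_apply J t w
        right_inv := fun w => exp_neg_apply_exp_apply J t w }
    let R : E3 ≃ₗᵢ[ℝ] E3 := { L with norm_map' := fun w => norm_exp_crossCLM Ω w (-t) }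
    exact ⟨R, fun w => rfl, fun w => rfl⟩
  -- the heat equation for `θ` in the Carleman frame, on the far past
  have hheatθ : ∀ z ∈ Iio t₁ ×ˢ (univ : Set (EuclideanSpace ℝ (Fin 3))),
      Carleman.dt (uncurry θ) z = Carleman.lap (uncurry θ) z := by
    rintro ⟨t, y⟩ hz
    have ht1 : t < t₁ := (mem_prod.1 hz).1
    have ht : t < 0 := lt_of_lt_of_le ht1 ht₁
    have hz0 : (t, y) ∈ Iio (0 : ℝ) ×ˢ (univ : Set (EuclideanSpace ℝ (Fin 3))) := ⟨ht, mem_univ _⟩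
    set p : EuclideanSpace ℝ (Fin 3) := E t y + c t with hp
    have hzp : (t, p) ∈ Iio (0 : ℝ) ×ˢ (univ : Set (EuclideanSpace ℝ (Fin 3))) := ⟨ht, mem_univ _⟩
    have hdθ : DifferentiableAt ℝ (uncurry θ) (t, y) :=
      (hθ2.differentiableOn (by norm_num)).differentiableAt (hO.mem_nhds hz0)
    have hdω : DifferentiableAt ℝ (uncurry (vorticity v)) (t, p) :=
      (hω2.differentiableOn (by norm_num)).differentiableAt (hO.mem_nhds hzp)
    -- the inner curve `s ↦ (s, E s y + c s)` has velocity `(1, ξ p)`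
    have hγ : HasDerivAt (fun s : ℝ => (s, E s y + c s)) ((1 : ℝ), b + J p) t := by
      have h := (hasDerivAt_id t).prodMk ((hEd t y).add (hcd t))
      have e : J (E t y) + (bpar + J (E t p')) = b + J p := by rw [hp]; exact hframe t y
      rw [← e]
      exact h
    have hcomp : HasDerivAt (uncurry (vorticity v) ∘ fun s : ℝ => (s, E s y + c s))
        (fderiv ℝ (uncurry (vorticity v)) (t, p) ((1 : ℝ), b + J p)) t := by
      have hdω' : HasFDerivAt (uncurry (vorticity v)) (fderiv ℝ (uncurry (vorticity v)) (t, p))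
          ((fun s : ℝ => (s, E s y + c s)) t) := by
        simpa only [hp] using hdω.hasFDerivAt
      exact hdω'.comp_hasDerivAt t hγ
    have hsplit : fderiv ℝ (uncurry (vorticity v)) (t, p) ((1 : ℝ), b + J p) =
        timeDeriv (vorticity v) t p + fderiv ℝ (vorticity v t) p (b + J p) := by
      have e : ((1 : ℝ), b + J p) = ((1 : ℝ), (0 : EuclideanSpace ℝ (Fin 3))) + ((0 : ℝ), b + J p) := by simp
      rw [e, map_add, ← Carleman.dt_apply, ← Carleman.dx_apply, Carleman.dt_uncurry hdω, Carleman.dx_uncurry hdω]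
    -- the outer rotation `s ↦ E (−s)` applied to the inner curve
    have houter : HasDerivAt (fun s : ℝ => θ s y)
        (-(J (E (-t) (vorticity v t p))) + E (-t) (fderiv ℝ (uncurry (vorticity v)) (t, p) ((1 : ℝ), b + J p))) t := by
      have h1 : HasDerivAt (fun s : ℝ => E (-s)) (-(J * E (-t))) t := by
        have h := (hasDerivAt_exp_smul_const' (𝕂 := ℝ) J (-t)).scomp t (hasDerivAt_neg' t)
        have e2 : (-1 : ℝ) • (J * NormedSpace.exp ((-t) • J)) = -(J * NormedSpace.exp ((-t) • J)) :=
          neg_one_smul ℝ (J * NormedSpace.exp ((-t) • J))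
        rw [e2] at h
        exact h
      have h2 := h1.clm_apply hcomp
      have hfun : (fun s : ℝ => θ s y) = fun s => (E (-s)) ((uncurry (vorticity v) ∘ fun s : ℝ => (s, E s y + c s)) s) := by
        funext s; simp [hθ, vorticity_apply]
      rw [hfun]
      refine h2.congr_deriv ?_
      have e3 : ((uncurry (vorticity v)) ∘ fun s : ℝ => (s, E s y + c s)) t = vorticity v t p := by
        simp only [Function.comp_apply, Function.uncurry_apply_pair, hp]
      rw [e3]
      rfl
    have hdt : Carleman.dt (uncurry θ) (t, y) =
        -(J (E (-t) (vorticity v t p))) + E (-t) (timeDeriv (vorticity v) t p + fderiv ℝ (vorticity v t) p (b + J p)) := by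
      rw [Carleman.dt_uncurry hdθ, Literature.Analysis.FluidPDE.timeDeriv_apply, houter.deriv, hsplit]
    have hlaw' : timeDeriv (vorticity v) t p =
        (Δ (vorticity v t)) p + J (vorticity v t p) - fderiv ℝ (vorticity v t) p (b + J p) := by
      rw [Literature.Analysis.FluidPDE.timeDeriv_apply, ← derivWithin_of_isOpen isOpen_Iio ht, ← timeDerivWithin_apply]
      exact hlaw t ht1 p
    have hlap : Carleman.lap (uncurry θ) (t, y) = E (-t) ((Δ (vorticity v t)) p) := by
      rw [Carleman.lap_uncurry hO hz0 hθ2]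
      obtain ⟨R, hR, hRs⟩ := hRot t
      have hfun : θ t = fun z => R ((fun w => vorticity v t (w + c t)) (R.symm z)) := by
        funext z; simp [hθ, hR, hRs, vorticity_apply]
      have hL := laplacian_conj_linearIsometryEquiv R (fun w => vorticity v t (w + c t)) y
      rw [hfun, hL, hR, hRs, laplacian_comp_add_right]
    have comm : J (E (-t) (vorticity v t p)) = E (-t) (J (vorticity v t p)) := crossCLM_exp_apply J (-t) _
    rw [hdt, hlaw', hlap, sub_add_cancel, map_add, comm]
    abel
  -- constancy on the far-past slab
  have key : ∀ t t' : ℝ, t < t₁ → t' < t₁ → ∀ y y' : EuclideanSpace ℝ (Fin 3), θ t y = θ t' y' := by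
    intro t t' ht ht' y y'
    have h := Literature.Analysis.PDE.heat_liouville (u := uncurry θ) (T := t₁) (A := K) (γ := 0) le_rfl
      zero_lt_one (hθ2.mono hsub₁) hheatθ ?_ (z := (t, y)) (w := (t', y')) (mem_prod.2 ⟨ht, mem_univ _⟩)
      (mem_prod.2 ⟨ht', mem_univ _⟩)
    · simpa using h
    · rintro ⟨τ, z⟩ hz
      have hτ : τ < 0 := lt_of_lt_of_le (mem_prod.1 hz).1 ht₁
      rw [Real.rpow_zero, mul_one]
      simp only [uncurry, hθ, hE, hJ, norm_exp_crossCLM]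
      exact hK τ hτ _
  -- every far-past slice is a constant field …
  have hslice : ∀ t < t₁, ∀ x x' : EuclideanSpace ℝ (Fin 3), curl (v t) x = curl (v t) x' := by
    intro t ht x x'
    have h := key t t ht ht (E (-t) (x - c t)) (E (-t) (x' - c t))
    have e1 : ∀ w, E t (E (-t) w) = w := fun w => exp_apply_exp_neg_apply J t w
    simp only [hθ, e1, sub_add_cancel] at h
    have h2 := congrArg (fun w => E t w) h
    simpa only [e1] using h2
  -- … and a constant field tangent to the spheres about `x₀` vanishes
  intro t ht x
  have ht0 : t < 0 := lt_of_lt_of_le ht ht₁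
  set c₀ := curl (v t) x with hc₀
  have h1 : curl (v t) (x₀ + c₀) = c₀ := hslice t ht (x₀ + c₀) x
  have h2 : ⟪x₀ + c₀ - x₀, curl (v t) (x₀ + c₀)⟫ = 0 := hun t ht0 (x₀ + c₀)
  rw [h1, add_sub_cancel_left] at h2
  exact inner_self_eq_zero.1 h2


end Killing

end Summit.NavierStokesRegularity.NavierStokesRegularity.Theorems.PoloidalLiouville.Antidynamo

end
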